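import Summits.ValiantsHypothesis.ValiantsHypothesis.Theorems.CommutativityDial
import HarnessLib

/-!
# The interval projection of the free algebra (Hrubeš–Wigderson–Yehudayoff's `g ↦ g^{(I)}`)

Hrubeš–Wigderson–Yehudayoff (CCC 2010 / ECCC TR10-021, "Relationless completeness and separations",
proof of Theorem F.1): for a noncommutative polynomial `g` and an interval of positions `I = [j, j+m)`,
`g^{(I)}` is the commutative polynomial whose coefficient at the monomial of a word `α` of length `m`
whose letters sit at the consecutive positions of `I` is `COEF_α(g)` (positions are read off the
variables by a map `col : σ → ℕ`; for the permanent, the position of `x_{i,t}` is its column `t`).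
This file builds `ordProj col j m : FreeAlgebra R σ →ₗ[R] MvPolynomial σ R` through Mathlib's
identification `FreeAlgebra R σ ≃ₐ MonoidAlgebra R (FreeMonoid σ)` and proves the three rules that
drive HWY's ordered circuit (`Theorems.NcOrderedTransfer`): generators and constants
(`ordProj_ι`, `ordProj_algebraMap`), and the CONVOLUTION RULE
`(g h)^{[j,j+m)} = Σ_{l ≤ m} g^{[j,j+l)} · h^{[j+l,j+m)}` (`ordProj_mul`, from the word-level
`wordOrd_append` by bilinearity); and that the full-interval part of the ordered permanent
`ncPerPoly n` of `Theorems.CommutativityDial` is the permanent (`ordProj_ncPerPoly`).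
HONEST FRAMING: algebraic bookkeeping for a published simulation; nothing here bears on `VP ≠ VNP`.

## References
* [HrubesWigdersonYehudayoff2010] P. Hrubeš, A. Wigderson, A. Yehudayoff, Relationless completeness and
  separations, CCC 2010 (full version ECCC TR10-021), Thm 1.11, proof of Thm F.1.
-/

noncomputable section

namespace Summit.ValiantsHypothesis.ValiantsHypothesis.Theorems.NcIntervalProjection

open Literature.Computability.AlgebraicComplexity hiding ncPerPoly
open Literature.Computability.AlgebraicComplexity.ArithCircuit
open Summit.ValiantsHypothesis.ValiantsHypothesis.Theorems.CommutativityDial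
open MvPolynomial

universe u v

variable {R : Type u} [CommSemiring R] {σ : Type v} (col : σ → ℕ)

/-! ## §1 Words sitting at consecutive positions -/

/-- `isOrdAt col j w`: the letters of the word `w` sit at the consecutive positions
`j, j+1, …, j + |w| - 1` (HWY10: a monomial "of type `[j, j+|w|)`").
[cite: HrubesWigdersonYehudayoff2010, Thm F.1] -/
def isOrdAt : ℕ → List σ → Bool
  | _, [] => true
  | j, x :: w => (col x == j) && isOrdAt (j + 1) w

/-- Position bookkeeping under concatenation. [cite: HrubesWigdersonYehudayoff2010, Thm F.1] -/
theorem isOrdAt_append (j : ℕ) (w₁ w₂ : List σ) :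
    isOrdAt col j (w₁ ++ w₂) = (isOrdAt col j w₁ && isOrdAt col (j + w₁.length) w₂) := by
  induction w₁ generalizing j with
  | nil => simp [isOrdAt]
  | cons x w ih =>
    simp only [List.cons_append, isOrdAt, ih, List.length_cons, Bool.and_assoc]
    congr 2
    rw [Nat.add_assoc, Nat.add_comm 1]

/-- Words enumerated along their positions are ordered. [cite: HrubesWigdersonYehudayoff2010, Thm F.1] -/
theorem isOrdAt_ofFn {m : ℕ} (j : ℕ) (f : Fin m → σ) (hf : ∀ i, col (f i) = j + i) :
    isOrdAt col j (List.ofFn f) = true := by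
  induction m generalizing j with
  | zero => simp [isOrdAt]
  | succ m ih =>
    rw [List.ofFn_succ]
    simp only [isOrdAt, Bool.and_eq_true, beq_iff_eq]
    refine ⟨by simpa using hf 0, ih (j + 1) (fun i => f i.succ) fun i => ?_⟩
    rw [hf i.succ, Fin.val_succ]; omega

/-- The ordered commutative image of ONE word at the interval `[j, j+m)`: the commutative monomial of
the word if it has length `m` and sits at positions `j, …, j+m-1`, else `0`.
[cite: HrubesWigdersonYehudayoff2010, Thm F.1] -/
def wordOrd (j m : ℕ) (w : List σ) : MvPolynomial σ R :=
  if w.length = m ∧ isOrdAt col j w = true then (w.map X).prod else 0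

omit [CommSemiring R] in
/-- A word of the wrong length contributes nothing. [cite: HrubesWigdersonYehudayoff2010, Thm F.1] -/
theorem wordOrd_of_length_ne [CommSemiring R] {j m : ℕ} {w : List σ} (h : w.length ≠ m) :
    wordOrd (R := R) col j m w = 0 :=
  if_neg fun h' => h h'.1

/-- **Convolution rule for words**: the interval image of a concatenation splits over the cut
position. [cite: HrubesWigdersonYehudayoff2010, Thm F.1] -/
theorem wordOrd_append (j m : ℕ) (w₁ w₂ : List σ) :
    wordOrd (R := R) col j m (w₁ ++ w₂) =
      ∑ l ∈ Finset.range (m + 1), wordOrd col j l w₁ * wordOrd col (j + l) (m - l) w₂ := by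
  by_cases hle : w₁.length ≤ m
  · rw [Finset.sum_eq_single_of_mem w₁.length (Finset.mem_range.2 (Nat.lt_succ_of_le hle))
      (fun l _ hl => by rw [wordOrd_of_length_ne col (Ne.symm hl), zero_mul])]
    simp only [wordOrd, List.length_append, List.map_append, List.prod_append, isOrdAt_append,
      Bool.and_eq_true, true_and]
    by_cases hB : isOrdAt col j w₁ = true
    · by_cases hC : w₂.length = m - w₁.length ∧ isOrdAt col (j + w₁.length) w₂ = true
      · rw [if_pos hB, if_pos hC, if_pos ⟨by omega, hB, hC.2⟩]
      · rw [if_pos hB, if_neg hC, mul_zero, if_neg]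
        rintro ⟨hA, -, hA'⟩
        exact hC ⟨by omega, hA'⟩
    · rw [if_neg hB, zero_mul, if_neg]
      rintro ⟨-, hA, -⟩
      exact hB hA
  · rw [wordOrd_of_length_ne col (by simp; omega)]
    refine (Finset.sum_eq_zero fun l hl => ?_).symm
    rw [wordOrd_of_length_ne col (by have := Finset.mem_range.1 hl; omega), zero_mul]

/-! ## §2 The interval projection of the free algebra -/

/-- The interval projection on the monoid algebra of the free monoid (noncommutative polynomials
with their coefficients exposed): `Σ_w coeff_w • wordOrd col j m w`.
[cite: HrubesWigdersonYehudayoff2010, Thm F.1] -/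
def ordProjMA (j m : ℕ) : MonoidAlgebra R (FreeMonoid σ) →ₗ[R] MvPolynomial σ R :=
  Finsupp.linearCombination R (fun w : FreeMonoid σ => wordOrd col j m (FreeMonoid.toList w)) ∘ₗ
    (MonoidAlgebra.coeffLinearEquiv R).toLinearMap

/-- Value on a monomial. [cite: HrubesWigdersonYehudayoff2010, Thm F.1] -/
@[simp] theorem ordProjMA_single (j m : ℕ) (w : FreeMonoid σ) (r : R) :
    ordProjMA col j m (MonoidAlgebra.single w r) = r • wordOrd col j m (FreeMonoid.toList w) := by
  simp [ordProjMA, Finsupp.linearCombination_single]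

/-- **Convolution rule** on the monoid algebra (bilinear extension of `wordOrd_append`).
[cite: HrubesWigdersonYehudayoff2010, Thm F.1] -/
theorem ordProjMA_mul (j m : ℕ) (x y : MonoidAlgebra R (FreeMonoid σ)) :
    ordProjMA col j m (x * y) =
      ∑ l ∈ Finset.range (m + 1), ordProjMA col j l x * ordProjMA col (j + l) (m - l) y := by
  induction x using MonoidAlgebra.induction_linear with
  | zero => simp
  | add x x' hx hx' => simp only [add_mul, map_add, hx, hx', Finset.sum_add_distrib]
  | single w₁ r₁ =>
    induction y using MonoidAlgebra.induction_linear with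
    | zero => simp
    | add y y' hy hy' => simp only [mul_add, map_add, hy, hy', Finset.sum_add_distrib]
    | single w₂ r₂ =>
      rw [MonoidAlgebra.single_mul_single, ordProjMA_single, FreeMonoid.toList_mul, wordOrd_append,
        Finset.smul_sum]
      refine Finset.sum_congr rfl fun l _ => ?_
      rw [ordProjMA_single, ordProjMA_single, smul_mul_smul_comm]

/-- The interval projection `g ↦ g^{([j, j+m))}` of the free algebra to commutative polynomials
(HWY10, proof of Thm F.1: "`COEF_{α^{(I)}}(g^{(I)}) = COEF_α(g)`"), through Mathlib's identification
of the free algebra with the monoid algebra of the free monoid.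
[cite: HrubesWigdersonYehudayoff2010, Thm F.1] -/
def ordProj (j m : ℕ) : FreeAlgebra R σ →ₗ[R] MvPolynomial σ R :=
  ordProjMA col j m ∘ₗ (FreeAlgebra.equivMonoidAlgebraFreeMonoid (R := R) (X := σ)).toLinearMap

/-- Unfolding. [cite: HrubesWigdersonYehudayoff2010, Thm F.1] -/
theorem ordProj_apply (j m : ℕ) (g : FreeAlgebra R σ) :
    ordProj col j m g = ordProjMA col j m (FreeAlgebra.equivMonoidAlgebraFreeMonoid g) := rfl

/-- **Convolution rule** `(g h)^{[j,j+m)} = Σ_l g^{[j,j+l)} h^{[j+l,j+m)}` — the product gates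
`(v, I)` of HWY's ordered circuit. [cite: HrubesWigdersonYehudayoff2010, Thm F.1] -/
theorem ordProj_mul (j m : ℕ) (g h : FreeAlgebra R σ) :
    ordProj col j m (g * h) =
      ∑ l ∈ Finset.range (m + 1), ordProj col j l g * ordProj col (j + l) (m - l) h := by
  simp only [ordProj_apply, map_mul, ordProjMA_mul]

/-- A variable sits at one position: `(x_i)^{[j,j+1)} = x_i` if `i` has position `j`, all other
interval parts vanish. [cite: HrubesWigdersonYehudayoff2010, Thm F.1] -/
theorem ordProj_ι (j m : ℕ) (x : σ) :
    ordProj col j m (FreeAlgebra.ι R x) = if m = 1 ∧ col x = j then (X x : MvPolynomial σ R) else 0 := by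
  rw [ordProj_apply]
  have : FreeAlgebra.equivMonoidAlgebraFreeMonoid (FreeAlgebra.ι R x) =
      MonoidAlgebra.single (FreeMonoid.of x) (1 : R) := by
    simp [FreeAlgebra.equivMonoidAlgebraFreeMonoid, MonoidAlgebra.of_apply]
  rw [this, ordProjMA_single, one_smul, FreeMonoid.toList_of]
  simp only [wordOrd, List.length_singleton, isOrdAt, Bool.and_true, beq_iff_eq, List.map_cons,
    List.map_nil, List.prod_cons, List.prod_nil, mul_one]
  by_cases h : m = 1 ∧ col x = j
  · rw [if_pos h, if_pos ⟨h.1.symm, h.2⟩]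
  · rw [if_neg h, if_neg (by rintro ⟨h1, h2⟩; exact h ⟨h1.symm, h2⟩)]

/-- A constant sits at no position: only its empty-interval part survives.
[cite: HrubesWigdersonYehudayoff2010, Thm F.1] -/
theorem ordProj_algebraMap (j m : ℕ) (c : R) :
    ordProj col j m (algebraMap R (FreeAlgebra R σ) c) = if m = 0 then C c else 0 := by
  rw [ordProj_apply, AlgEquiv.commutes, MonoidAlgebra.coe_algebraMap, Function.comp_apply,
    show (algebraMap R R) c = c from rfl, ordProjMA_single, FreeMonoid.toList_one]
  simp only [wordOrd, List.length_nil, isOrdAt, and_true, List.map_nil, List.prod_nil]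
  by_cases h : m = 0
  · rw [if_pos h, if_pos h.symm, smul_eq_C_mul, mul_one]
  · rw [if_neg h, if_neg (Ne.symm h), smul_zero]

/-- The unit. [cite: HrubesWigdersonYehudayoff2010, Thm F.1] -/
theorem ordProj_one (j m : ℕ) :
    ordProj col j m (1 : FreeAlgebra R σ) = if m = 0 then 1 else 0 := by
  rw [← map_one (algebraMap R (FreeAlgebra R σ)), ordProj_algebraMap, C_1]

/-- The image of a bare word `ι x₁ ⋯ ι x_r` in the monoid algebra is the monomial of the word.
[cite: HrubesWigdersonYehudayoff2010, Thm F.1] -/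
theorem equiv_prod_map_ι (l : List σ) :
    FreeAlgebra.equivMonoidAlgebraFreeMonoid ((l.map (FreeAlgebra.ι R)).prod) =
      MonoidAlgebra.single (FreeMonoid.ofList l) (1 : R) := by
  induction l with
  | nil => simp [MonoidAlgebra.one_def]
  | cons x l ih =>
    rw [List.map_cons, List.prod_cons, map_mul, ih]
    have : FreeAlgebra.equivMonoidAlgebraFreeMonoid (FreeAlgebra.ι R x) =
        MonoidAlgebra.single (FreeMonoid.of x) (1 : R) := by
      simp [FreeAlgebra.equivMonoidAlgebraFreeMonoid, MonoidAlgebra.of_apply]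
    rw [this, MonoidAlgebra.single_mul_single, mul_one]
    rfl

/-- **The ordered permanent projects to the permanent**: every word of `ncPerPoly n` reads column `t`
at position `t`, so its full-interval part `[0, n)` (positions = columns) is `per_n` itself
(HWY10 §1.4: `PERM_n` is ordered). [cite: HrubesWigdersonYehudayoff2010, Thm 1.11] -/
theorem ordProj_ncPerPoly (n : ℕ) :
    ordProj (fun x : Fin n × Fin n => (x.2 : ℕ)) 0 n (ncPerPoly (k := R) n) = perPoly (Fin n) R := by
  rw [ncPerPoly, map_sum]
  have hper : perPoly (Fin n) R = ∑ π : Equiv.Perm (Fin n), ∏ i, (X (π i, i) : MvPolynomial _ R) := by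
    simp [perPoly, Matrix.permanent, Matrix.mvPolynomialX]
  rw [hper]
  refine Finset.sum_congr rfl fun π _ => ?_
  rw [ordProj_apply, show (List.ofFn fun i : Fin n => FreeAlgebra.ι R (π i, i)) =
      (List.ofFn fun i : Fin n => (π i, i)).map (FreeAlgebra.ι R) from List.map_ofFn.symm,
    equiv_prod_map_ι, ordProjMA_single, one_smul, FreeMonoid.toList_ofList]
  simp only [wordOrd, List.length_ofFn, true_and]
  rw [if_pos (isOrdAt_ofFn _ 0 _ fun i => by simp), List.map_ofFn, List.prod_ofFn]
  rfl

end Summit.ValiantsHypothesis.ValiantsHypothesis.Theorems.NcIntervalProjection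

end
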